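import Summits.QuantumFields.YangMills.Theorems.FluctuationComparisonRegPrIntLS2BetaStageAxialFeedback
import Summits.QuantumFields.YangMills.Theorems.FluctuationComparisonRegPrIntLS2BetaRelFlapOfFeedersAlgebra
import HarnessLib

/-!
# S2β · the (D-stage) REL-TEL road — THE (H♭♭) FEEDERS DOOR: ✓p824471's two-tower letter-with-feedback `HLW = ∃ r e W, …` ⟸ the five per-level feeders
# {(L♭) chart, F1-rel = the relative key-lemma TOWER with ABSTRACT junk `η^A_s ≤ qd_s·B_s + qU_s·B_{s+1}` (px10 FILE 11 shape), F2-rel = the two-tower flap letter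
# (px21 C4 shape), (F3)-rel = relative lift curvature, (R1) chord}, with `e`, `W`, `C = X₁(a₁ + a₂C_F√L)` EXPLICIT and the W-smallness reduced to the
# GEOMETRIC AMPLIFICATION functional `G(x) = Σ_{j<N}Σ_{u≤j} L^{j−u}·x_u`; plus ★`G_le_of_bkgPriced`: a BACKGROUND-priced `x_u ≤ κ·L^{2u}·(L⁻¹)^{2N}` has `G(x) ≤ κL∕((L−1)(L²−1))`, N-free

Cell `ym3-torus` (rung R3 = continuum `SU(2)` Yang–Mills on T³ — NOT d = 4, NOT infinite volume, NOT a mass gap, NOT Clay).  Width seat «width 12» `ym3-torus-px12`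
(gen 24), FREE px helper on crux `stmt-QuantumFields-20520`; `--kind proof --supports … --as helper`, count-neutral, DEFINITION-FREE (0 `def`∕`instance`∕`notation`∕`sorry`).

WHAT IT IS FOR.  ✓p824471 `dockRel_of_towers_feedback`∕`dStage_of_feedbackLetter` eat the letter (H♭♭) per level `j < N = K − J` along the two stage towers
(`B_u = ‖dist1(U′_u·U′₀_u⁻¹)‖₂`, `S` = the fine relative plaquettes, `A_t` = the level-`t` relative plaquettes of the gauge-fixed towers, `V_j, V₀_j` the two lifts):
`flap_j ≤ √L·e_j·B_{j+1} + (C(√L)^j·S + Σ_{u≤j} W j u·B_u)`, `Σ(r+e) ≤ E`, `e^E·Σ_jΣ_{u≤j}(√L)^{j−u}W j u ≤ ½`.  This file is the pure `ℓ²`∕index algebra turning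
the FEEDERS into that letter (the two-tower twin of px17 ✓`…HFlatOfFeeders.relLetter_of_feeders`):
* F1-rel (px10 ✓`relKeyLemma_torus_of_step`, FILE 11 — ABSTRACT junk): `A_t ≤ X₁·((√L)^t·S + Σ_{s<t}(√L)^{t−1−s}·η^A_s)`, with the MENU `η^A_s ≤ qd_s·B_s + qU_s·B_{s+1}`;
* F2-rel (px21 C4 ✓∕⧗`sqrt_sum_dist1_flap_rel_sq_le` shape): `flap_j ≤ a₁·A_j + a₂·A^V_j + η_j·B_j + ζ_j·B^V_j`;
* (F3)-rel (✓`…WhitneyHatLiftCurvatureRelative` shape): `A^V_j ≤ C_F·A_{j+1} + φ_j·Λ_{j+1}`;  (R1) chord: `B^V_j ≤ √L·Λ_{j+1}`;  (L♭) (✓p823489): `Λ_{j+1} ≤ (1+r_j)·B_{j+1}`.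
OUTPUT (explicit): `e_j = (a₂C_FX₁·qU_j + a₂φ_j(1+r_j))∕√L + ζ_j(1+r_j)`, `C = X₁(a₁ + a₂C_F√L)`, `W j u` the displayed finite sum, and
★`sum_sqrtL_pow_mul_W_le`: `Σ_{u≤j}(√L)^{j−u}·W j u ≤ (C∕√L)·G_j(qd) + (C∕L)·G_j(qU) + η_j` (`G_j(x) = Σ_{u≤j}L^{j−u}x_u`) — so the W-smallness is
`e^E·((C∕√L)·G(qd) + (C∕L)·G(qU) + Σ_jη_j) ≤ ½`, and ★`G_le_of_bkgPriced` discharges `G` for BACKGROUND-priced coefficients (✓p825096 `bkgTower_of_bkgLetter`: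
`θ₀,u = 2C₁θ_J·L^{2u}(L⁻¹)^{2N}`), UNIFORMLY IN THE DEPTH `N`.
‼ ADMISSIBILITY (UV3-NODE §84.8, bus 14:20Z): a junk coefficient priced by a RELATIVE sup (`β♯_u`) or by the history size (`θ_u ~ θBal(K−u)`, only `√L`-geometric) gives
`G ~ (√L)^N` — NOT admissible; the additive `1.1·10⁷·β²` of ✓`relOneLevelStep_bkg` is of that kind (β ≥ the coarse-bond relative deviation), and the cure is the
second-order (chord) distortion letter ✓p822698 `norm_sub_le_mul_norm_exp_imQuat_sub`, which makes the quadratic-relative loss MULTIPLICATIVE (→ `ε_t`, inside `X₁`).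
* §1 pure bookkeeping over `ℝ`: `sum_range_ite_mul`, the `√L`-power identities, ★`sum_W_mul_eq`, ★`sum_sqrtL_pow_mul_W_le`, ★`G_le_of_bkgPriced`, ★★`flap_le_of_feeders_level`;
* §2 ★★★`feedbackLetter_of_feeders` — the tower-instantiated door: its conclusion is ✓p824471's `hH` VERBATIM; ★★`dockRel_of_feeders` = ✓`dockRel_of_towers_feedback` ∘ it.
HONEST SCOPE.  Finite sums; nothing of Bałaban's analysis is asserted; the feeders' INSTANTIATION on the T³ record (px10 FILE 11 at `(g_0•U, g₀_0•U₀)` rewritten by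
(T3), px21 C4 at `(U′_j, V_j; U′₀_j, V₀_j)`, (F3)-rel at the hat weights), the BKG-priced (C)-step v2, (D-ax)∕(D♮), (F♮), GAP♯∘ (`stub_uniformFibreGapOrbit`), S2β, the five
registered stubs (0∕5), crux 20520 and `YM3TorusSU2` are NOT proved; no registered stub is closed; the Yang–Mills mass gap is NOT proved.
References: T. Bałaban, CMP **99** (1985) 75–102 [Balaban1985RegularSpaces] ((1.29) p.81, Lemma 1 p.79); CMP **98** (1985) 17–51 [Balaban1985Averaging] ((19)–(21) pp.21–22);
CMP **102** (1985) 277–309 [Balaban1985Variational] ((4) p.278).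
-/

set_option autoImplicit false

noncomputable section

namespace Summit.QuantumFields.YangMills.Theorems.FluctuationComparisonRegPrIntLS2BetaRelFlapOfFeeders

open Finset
open scoped Real
open Literature.MathematicalPhysics.QuantumLattice (su2Quat)
open Literature.MathematicalPhysics.QuantumFieldTheory.Balaban1983to89
open T4Continuum T3ContinuumYM3Torus T3UnitScaleTilt T3TiltDescent T3LevelShift BlockAveraging
open T4CubeChartGnomonic (SU2)
open T4ExpWindowSmallField (logVec)
open T3UnitLawDensityEML (ℰp)
open T3ConstrainedMinimiser (fibre)
open Summit.QuantumFields.YangMills.Theorems.FluctuationComparisonRegPrIntLS2BetaStageAxialFeedback (dockRel_of_towers_feedback)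
open Summit.QuantumFields.YangMills.Theorems.FluctuationComparisonRegPrIntLS2BetaRelFlapOfFeedersAlgebra
  (W_nonneg sum_sqrtL_pow_mul_W_le flap_le_of_feeders_level)

/-! ## §2 The tower-instantiated door -/

variable (F : T3Family) {J K : ℕ}

/-- ★★★ **THE (H♭♭) FEEDERS DOOR**: along the two stage towers (`U′_u := g_u • M^uU`, `U′₀_u := g₀_u • M^uU₀`, `V_j, V₀_j` the two lifts), the per-level
feeders — F1-rel = the relative key-lemma tower with ABSTRACT junk `η^A` and the menu `η^A_s ≤ qd_s·B_s + qU_s·B_{s+1}` (px10 FILE 11 shape, at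
`(g_0•U, g₀_0•U₀)` rewritten by (T3)), F2-rel = the two-tower flap letter (px21 C4 shape), (F3)-rel (relative lift curvature), (R1) chord and (L♭) — give
✓p824471's letter-with-feedback `hH` VERBATIM, with `E := E_L + E_e`, `C := X₁(a₁ + a₂C_F√L)`, `e`, `W` explicit, under the displayed smallness
`e^E·((a₁X₁∕√L + a₂C_FX₁)·G(qd) + (a₁X₁∕L + a₂C_FX₁∕√L)·G(qU) + Σ_j η_j) ≤ ½`, `G(x) = Σ_{j<K−J}Σ_{u≤j}L^{j−u}x_u` (✓`G_le_of_bkgPriced`).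
[cite: Balaban1985RegularSpaces, (1.29) p.81, Lemma 1 p.79; Balaban1985Averaging, (19)-(21) pp.21-22] -/
theorem feedbackLetter_of_feeders (hL : 1 < (F.L : ℝ)) (U U₀ : GaugeField (F.P K) 0 SU2)
    (lift : (j : ℕ) → GaugeField (F.P K) (j + 1) SU2 → GaugeField (F.P K) j SU2)
    (hR1 : ∀ j, j < K - J → ∀ X X' : GaugeField (F.P K) (j + 1) SU2,
      ∑ b, dist1 (lift j X b * (lift j X' b)⁻¹) ^ 2 ≤ (F.L : ℝ) * ∑ e, ‖logVec (su2Quat (X e)) - logVec (su2Quat (X' e))‖ ^ 2)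
    (g g₀ : (j : ℕ) → Site (F.P K) j → SU2)
    {X₁ a₁ a₂ C_F E_L E_e : ℝ} (hX₁ : 0 ≤ X₁) (ha₁ : 0 ≤ a₁) (ha₂ : 0 ≤ a₂) (hCF : 0 ≤ C_F)
    (ηA r φ η ζ qd qU : ℕ → ℝ) (hr : ∀ j, 0 ≤ r j) (hφ : ∀ j, 0 ≤ φ j) (hη0 : ∀ j, 0 ≤ η j) (hζ : ∀ j, 0 ≤ ζ j)
    (hqd : ∀ s, 0 ≤ qd s) (hqU : ∀ s, 0 ≤ qU s)
    (hrE : ∑ j ∈ range (K - J), r j ≤ E_L)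
    (he : ∑ j ∈ range (K - J), ((a₂ * C_F * X₁ * qU j + a₂ * φ j * (1 + r j)) / Real.sqrt (F.L : ℝ) + ζ j * (1 + r j)) ≤ E_e)
    (hsmall : Real.exp (E_L + E_e) *
      ((a₁ * X₁ / Real.sqrt (F.L : ℝ) + a₂ * C_F * X₁) * ∑ j ∈ range (K - J), ∑ u ∈ range (j + 1), (F.L : ℝ) ^ (j - u) * qd u +
        (a₁ * X₁ / (F.L : ℝ) + a₂ * C_F * X₁ / Real.sqrt (F.L : ℝ)) * ∑ j ∈ range (K - J), ∑ u ∈ range (j + 1), (F.L : ℝ) ^ (j - u) * qU u +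
        ∑ j ∈ range (K - J), η j) ≤ 1 / 2)
    (hLflat : ∀ j, j < K - J →
      √(∑ b, ‖logVec (su2Quat (GaugeField.gaugeAct (g (j + 1)) (Averaging.iter (fun k => blockAvg (P := F.P K) (j := k) ℰp) (j + 1) U) b)) -
                logVec (su2Quat (GaugeField.gaugeAct (g₀ (j + 1)) (Averaging.iter (fun k => blockAvg (P := F.P K) (j := k) ℰp) (j + 1) U₀) b))‖ ^ 2) ≤
        (1 + r j) * √(∑ b, dist1 (GaugeField.gaugeAct (g (j + 1)) (Averaging.iter (fun k => blockAvg (P := F.P K) (j := k) ℰp) (j + 1) U) b *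
                  (GaugeField.gaugeAct (g₀ (j + 1)) (Averaging.iter (fun k => blockAvg (P := F.P K) (j := k) ℰp) (j + 1) U₀) b)⁻¹) ^ 2))
    (hF1 : ∀ t, t ≤ K - J →
      √(∑ q, dist1 ((GaugeField.plaqHol (GaugeField.gaugeAct (g₀ t) (Averaging.iter (fun k => blockAvg (P := F.P K) (j := k) ℰp) t U₀)) q)⁻¹ *
                  GaugeField.plaqHol (GaugeField.gaugeAct (g t) (Averaging.iter (fun k => blockAvg (P := F.P K) (j := k) ℰp) t U)) q) ^ 2) ≤
        X₁ * (Real.sqrt (F.L : ℝ) ^ t * √(∑ p, dist1 ((GaugeField.plaqHol (GaugeField.gaugeAct (g₀ 0) U₀) p)⁻¹ * GaugeField.plaqHol (GaugeField.gaugeAct (g 0) U) p) ^ 2) +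
          ∑ s ∈ range t, Real.sqrt (F.L : ℝ) ^ (t - 1 - s) * ηA s))
    (hηA : ∀ s, s < K - J → ηA s ≤ qd s * √(∑ b, dist1 (GaugeField.gaugeAct (g s) (Averaging.iter (fun k => blockAvg (P := F.P K) (j := k) ℰp) s U) b *
                  (GaugeField.gaugeAct (g₀ s) (Averaging.iter (fun k => blockAvg (P := F.P K) (j := k) ℰp) s U₀) b)⁻¹) ^ 2) +
        qU s * √(∑ b, dist1 (GaugeField.gaugeAct (g (s + 1)) (Averaging.iter (fun k => blockAvg (P := F.P K) (j := k) ℰp) (s + 1) U) b *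
                  (GaugeField.gaugeAct (g₀ (s + 1)) (Averaging.iter (fun k => blockAvg (P := F.P K) (j := k) ℰp) (s + 1) U₀) b)⁻¹) ^ 2))
    (hF2 : ∀ j, j < K - J →
      √(∑ b, dist1 (GaugeField.gaugeAct (g j) (Averaging.iter (fun k => blockAvg (P := F.P K) (j := k) ℰp) j U) b *
                (lift j (GaugeField.gaugeAct (g (j + 1)) (Averaging.iter (fun k => blockAvg (P := F.P K) (j := k) ℰp) (j + 1) U)) b)⁻¹ *
              (GaugeField.gaugeAct (g₀ j) (Averaging.iter (fun k => blockAvg (P := F.P K) (j := k) ℰp) j U₀) b *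
                (lift j (GaugeField.gaugeAct (g₀ (j + 1)) (Averaging.iter (fun k => blockAvg (P := F.P K) (j := k) ℰp) (j + 1) U₀)) b)⁻¹)⁻¹) ^ 2) ≤
        a₁ * √(∑ q, dist1 ((GaugeField.plaqHol (GaugeField.gaugeAct (g₀ j) (Averaging.iter (fun k => blockAvg (P := F.P K) (j := k) ℰp) j U₀)) q)⁻¹ *
                  GaugeField.plaqHol (GaugeField.gaugeAct (g j) (Averaging.iter (fun k => blockAvg (P := F.P K) (j := k) ℰp) j U)) q) ^ 2) +
          a₂ * √(∑ q, dist1 ((GaugeField.plaqHol (lift j (GaugeField.gaugeAct (g₀ (j + 1)) (Averaging.iter (fun k => blockAvg (P := F.P K) (j := k) ℰp) (j + 1) U₀))) q)⁻¹ *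
                  GaugeField.plaqHol (lift j (GaugeField.gaugeAct (g (j + 1)) (Averaging.iter (fun k => blockAvg (P := F.P K) (j := k) ℰp) (j + 1) U))) q) ^ 2) +
          η j * √(∑ b, dist1 (GaugeField.gaugeAct (g j) (Averaging.iter (fun k => blockAvg (P := F.P K) (j := k) ℰp) j U) b *
                  (GaugeField.gaugeAct (g₀ j) (Averaging.iter (fun k => blockAvg (P := F.P K) (j := k) ℰp) j U₀) b)⁻¹) ^ 2) +
          ζ j * √(∑ b, dist1 (lift j (GaugeField.gaugeAct (g (j + 1)) (Averaging.iter (fun k => blockAvg (P := F.P K) (j := k) ℰp) (j + 1) U)) b *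
                  (lift j (GaugeField.gaugeAct (g₀ (j + 1)) (Averaging.iter (fun k => blockAvg (P := F.P K) (j := k) ℰp) (j + 1) U₀)) b)⁻¹) ^ 2))
    (hF3 : ∀ j, j < K - J →
      √(∑ q, dist1 ((GaugeField.plaqHol (lift j (GaugeField.gaugeAct (g₀ (j + 1)) (Averaging.iter (fun k => blockAvg (P := F.P K) (j := k) ℰp) (j + 1) U₀))) q)⁻¹ *
                  GaugeField.plaqHol (lift j (GaugeField.gaugeAct (g (j + 1)) (Averaging.iter (fun k => blockAvg (P := F.P K) (j := k) ℰp) (j + 1) U))) q) ^ 2) ≤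
        C_F * √(∑ q, dist1 ((GaugeField.plaqHol (GaugeField.gaugeAct (g₀ (j + 1)) (Averaging.iter (fun k => blockAvg (P := F.P K) (j := k) ℰp) (j + 1) U₀)) q)⁻¹ *
                  GaugeField.plaqHol (GaugeField.gaugeAct (g (j + 1)) (Averaging.iter (fun k => blockAvg (P := F.P K) (j := k) ℰp) (j + 1) U)) q) ^ 2) +
          φ j * √(∑ b, ‖logVec (su2Quat (GaugeField.gaugeAct (g (j + 1)) (Averaging.iter (fun k => blockAvg (P := F.P K) (j := k) ℰp) (j + 1) U) b)) -
                logVec (su2Quat (GaugeField.gaugeAct (g₀ (j + 1)) (Averaging.iter (fun k => blockAvg (P := F.P K) (j := k) ℰp) (j + 1) U₀) b))‖ ^ 2)) :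
    letI E : ℝ := E_L + E_e
    letI C : ℝ := X₁ * (a₁ + a₂ * C_F * Real.sqrt (F.L : ℝ))
      ∃ (r e : ℕ → ℝ) (W : ℕ → ℕ → ℝ), (∀ j, 0 ≤ r j) ∧ (∀ j, 0 ≤ e j) ∧ (∀ j u, 0 ≤ W j u) ∧ ∑ j ∈ range (K - J), (r j + e j) ≤ E ∧
        Real.exp E * ∑ j ∈ range (K - J), ∑ u ∈ range (j + 1), Real.sqrt (F.L : ℝ) ^ (j - u) * W j u ≤ 1 / 2 ∧
        ∀ j, j < K - J →
          √(∑ b, ‖logVec (su2Quat (GaugeField.gaugeAct (g (j + 1)) (Averaging.iter (fun k => blockAvg (P := F.P K) (j := k) ℰp) (j + 1) U) b)) -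
                logVec (su2Quat (GaugeField.gaugeAct (g₀ (j + 1)) (Averaging.iter (fun k => blockAvg (P := F.P K) (j := k) ℰp) (j + 1) U₀) b))‖ ^ 2) ≤
            (1 + r j) * √(∑ b, dist1 (GaugeField.gaugeAct (g (j + 1)) (Averaging.iter (fun k => blockAvg (P := F.P K) (j := k) ℰp) (j + 1) U) b *
              (GaugeField.gaugeAct (g₀ (j + 1)) (Averaging.iter (fun k => blockAvg (P := F.P K) (j := k) ℰp) (j + 1) U₀) b)⁻¹) ^ 2) ∧
          √(∑ b, dist1 (GaugeField.gaugeAct (g j) (Averaging.iter (fun k => blockAvg (P := F.P K) (j := k) ℰp) j U) b *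
                (lift j (GaugeField.gaugeAct (g (j + 1)) (Averaging.iter (fun k => blockAvg (P := F.P K) (j := k) ℰp) (j + 1) U)) b)⁻¹ *
              (GaugeField.gaugeAct (g₀ j) (Averaging.iter (fun k => blockAvg (P := F.P K) (j := k) ℰp) j U₀) b *
                (lift j (GaugeField.gaugeAct (g₀ (j + 1)) (Averaging.iter (fun k => blockAvg (P := F.P K) (j := k) ℰp) (j + 1) U₀)) b)⁻¹)⁻¹) ^ 2) ≤
            Real.sqrt (F.L : ℝ) * e j * √(∑ b, dist1 (GaugeField.gaugeAct (g (j + 1)) (Averaging.iter (fun k => blockAvg (P := F.P K) (j := k) ℰp) (j + 1) U) b *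
              (GaugeField.gaugeAct (g₀ (j + 1)) (Averaging.iter (fun k => blockAvg (P := F.P K) (j := k) ℰp) (j + 1) U₀) b)⁻¹) ^ 2) +
              (C * Real.sqrt (F.L : ℝ) ^ j *
                √(∑ p, dist1 ((GaugeField.plaqHol (GaugeField.gaugeAct (g₀ 0) U₀) p)⁻¹ * GaugeField.plaqHol (GaugeField.gaugeAct (g 0) U) p) ^ 2) +
               ∑ u ∈ range (j + 1), W j u * √(∑ b, dist1 (GaugeField.gaugeAct (g u) (Averaging.iter (fun k => blockAvg (P := F.P K) (j := k) ℰp) u U) b *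
                  (GaugeField.gaugeAct (g₀ u) (Averaging.iter (fun k => blockAvg (P := F.P K) (j := k) ℰp) u U₀) b)⁻¹) ^ 2)) := by
  have hL0 : 0 < (F.L : ℝ) := by linarith
  have hsq : 0 < Real.sqrt (F.L : ℝ) := Real.sqrt_pos.2 hL0
  refine ⟨r, fun j => (a₂ * C_F * X₁ * qU j + a₂ * φ j * (1 + r j)) / Real.sqrt (F.L : ℝ) + ζ j * (1 + r j),
    fun j u => ((∑ s ∈ range j, if u = s then a₁ * X₁ * Real.sqrt (F.L : ℝ) ^ (j - 1 - s) * qd s else 0) +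
          (∑ s ∈ range j, if u = s + 1 then a₁ * X₁ * Real.sqrt (F.L : ℝ) ^ (j - 1 - s) * qU s else 0) +
          (∑ s ∈ range (j + 1), if u = s then a₂ * C_F * X₁ * Real.sqrt (F.L : ℝ) ^ (j - s) * qd s else 0) +
          (∑ s ∈ range j, if u = s + 1 then a₂ * C_F * X₁ * Real.sqrt (F.L : ℝ) ^ (j - s) * qU s else 0) +
          (if u = j then η j else 0)), hr, fun j => ?_, fun j u => W_nonneg ha₁ ha₂ hCF hX₁ qd qU η hqd hqU hη0 j u, ?_, ?_, fun j hj => ⟨hLflat j hj, ?_⟩⟩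
  · have h1r : 0 ≤ 1 + r j := by linarith [hr j]
    exact add_nonneg (div_nonneg (add_nonneg (mul_nonneg (mul_nonneg (mul_nonneg ha₂ hCF) hX₁) (hqU j))
      (mul_nonneg (mul_nonneg ha₂ (hφ j)) h1r)) hsq.le) (mul_nonneg (hζ j) h1r)
  · rw [Finset.sum_add_distrib]; exact add_le_add hrE he
  · refine le_trans (mul_le_mul_of_nonneg_left (Finset.sum_le_sum fun j _ =>
      sum_sqrtL_pow_mul_W_le hL0 ha₁ ha₂ hCF hX₁ qd qU η hqd hqU j) (Real.exp_pos _).le) ?_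
    simpa only [Finset.sum_add_distrib, ← Finset.mul_sum] using hsmall
  · -- the level lemma on the tower sequences
    have hAj := hF1 j hj.le
    have hAj1 := hF1 (j + 1) (by omega)
    simp only [Nat.add_sub_cancel] at hAj1
    have hBv : √(∑ b, dist1 (lift j (GaugeField.gaugeAct (g (j + 1)) (Averaging.iter (fun k => blockAvg (P := F.P K) (j := k) ℰp) (j + 1) U)) b *
                  (lift j (GaugeField.gaugeAct (g₀ (j + 1)) (Averaging.iter (fun k => blockAvg (P := F.P K) (j := k) ℰp) (j + 1) U₀)) b)⁻¹) ^ 2) ≤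
        Real.sqrt (F.L : ℝ) * √(∑ b, ‖logVec (su2Quat (GaugeField.gaugeAct (g (j + 1)) (Averaging.iter (fun k => blockAvg (P := F.P K) (j := k) ℰp) (j + 1) U) b)) -
                logVec (su2Quat (GaugeField.gaugeAct (g₀ (j + 1)) (Averaging.iter (fun k => blockAvg (P := F.P K) (j := k) ℰp) (j + 1) U₀) b))‖ ^ 2) := by
      rw [← Real.sqrt_mul hL0.le]
      exact Real.sqrt_le_sqrt (hR1 j hj _ _)
    exact flap_le_of_feeders_level hL0 ha₁ ha₂ hCF hX₁
      (fun u => √(∑ b, dist1 (GaugeField.gaugeAct (g u) (Averaging.iter (fun k => blockAvg (P := F.P K) (j := k) ℰp) u U) b *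
                  (GaugeField.gaugeAct (g₀ u) (Averaging.iter (fun k => blockAvg (P := F.P K) (j := k) ℰp) u U₀) b)⁻¹) ^ 2))
      (fun t => √(∑ q, dist1 ((GaugeField.plaqHol (GaugeField.gaugeAct (g₀ t) (Averaging.iter (fun k => blockAvg (P := F.P K) (j := k) ℰp) t U₀)) q)⁻¹ *
                  GaugeField.plaqHol (GaugeField.gaugeAct (g t) (Averaging.iter (fun k => blockAvg (P := F.P K) (j := k) ℰp) t U)) q) ^ 2))
      (fun j => √(∑ q, dist1 ((GaugeField.plaqHol (lift j (GaugeField.gaugeAct (g₀ (j + 1)) (Averaging.iter (fun k => blockAvg (P := F.P K) (j := k) ℰp) (j + 1) U₀))) q)⁻¹ *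
                  GaugeField.plaqHol (lift j (GaugeField.gaugeAct (g (j + 1)) (Averaging.iter (fun k => blockAvg (P := F.P K) (j := k) ℰp) (j + 1) U))) q) ^ 2))
      (fun j => √(∑ b, dist1 (lift j (GaugeField.gaugeAct (g (j + 1)) (Averaging.iter (fun k => blockAvg (P := F.P K) (j := k) ℰp) (j + 1) U)) b *
                  (lift j (GaugeField.gaugeAct (g₀ (j + 1)) (Averaging.iter (fun k => blockAvg (P := F.P K) (j := k) ℰp) (j + 1) U₀)) b)⁻¹) ^ 2))
      (fun i => √(∑ b, ‖logVec (su2Quat (GaugeField.gaugeAct (g i) (Averaging.iter (fun k => blockAvg (P := F.P K) (j := k) ℰp) i U) b)) -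
                logVec (su2Quat (GaugeField.gaugeAct (g₀ i) (Averaging.iter (fun k => blockAvg (P := F.P K) (j := k) ℰp) i U₀) b))‖ ^ 2))
      (fun j => √(∑ b, dist1 (GaugeField.gaugeAct (g j) (Averaging.iter (fun k => blockAvg (P := F.P K) (j := k) ℰp) j U) b *
                (lift j (GaugeField.gaugeAct (g (j + 1)) (Averaging.iter (fun k => blockAvg (P := F.P K) (j := k) ℰp) (j + 1) U)) b)⁻¹ *
              (GaugeField.gaugeAct (g₀ j) (Averaging.iter (fun k => blockAvg (P := F.P K) (j := k) ℰp) j U₀) b *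
                (lift j (GaugeField.gaugeAct (g₀ (j + 1)) (Averaging.iter (fun k => blockAvg (P := F.P K) (j := k) ℰp) (j + 1) U₀)) b)⁻¹)⁻¹) ^ 2))
      ηA r φ η ζ qd qU hφ hζ (hLflat j hj) hBv hAj hAj1 (fun s hs => hηA s (by omega)) (hF2 j hj) (hF3 j hj)

/-- ★★ **THE COMPOSED DOOR, CERTIFIED BY THE KERNEL**: ✓p824471 `dockRel_of_towers_feedback` ∘ ★★★`feedbackLetter_of_feeders` — from the two towers'
facts used by the dock (`U, U₀` in the fibre, (T1)∕(T1′)∕(T6)∕(T5-res)) and the five feeders, the (D-ax)-shaped conclusion at `(U, (g_0⁻¹·g₀_0)•U₀)` with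
`C_D = 8·(e^{E_L+E_e}·X₁(a₁ + a₂C_F√L)∕(L−1))²`. [cite: Balaban1985RegularSpaces, (1.29) p.81, Lemma 1 p.79; Balaban1985Variational, (4) p.278] -/
theorem dockRel_of_feeders (hJK : J ≤ K) (hL : 1 < (F.L : ℝ)) {V : GaugeField (F.P J) 0 SU2}
    (U U₀ : GaugeField (F.P K) 0 SU2) (hU : U ∈ fibre F ℰp J K hJK V) (hU₀ : U₀ ∈ fibre F ℰp J K hJK V)
    (lift : (j : ℕ) → GaugeField (F.P K) (j + 1) SU2 → GaugeField (F.P K) j SU2)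
    (hR1 : ∀ j, j < K - J → ∀ X X' : GaugeField (F.P K) (j + 1) SU2,
      ∑ b, dist1 (lift j X b * (lift j X' b)⁻¹) ^ 2 ≤ (F.L : ℝ) * ∑ e, ‖logVec (su2Quat (X e)) - logVec (su2Quat (X' e))‖ ^ 2)
    (g g₀ : (j : ℕ) → Site (F.P K) j → SU2)
    {X₁ a₁ a₂ C_F E_L E_e : ℝ} (hX₁ : 0 ≤ X₁) (ha₁ : 0 ≤ a₁) (ha₂ : 0 ≤ a₂) (hCF : 0 ≤ C_F)
    (ηA r φ η ζ qd qU : ℕ → ℝ) (hr : ∀ j, 0 ≤ r j) (hφ : ∀ j, 0 ≤ φ j) (hη0 : ∀ j, 0 ≤ η j) (hζ : ∀ j, 0 ≤ ζ j)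
    (hqd : ∀ s, 0 ≤ qd s) (hqU : ∀ s, 0 ≤ qU s)
    (hrE : ∑ j ∈ range (K - J), r j ≤ E_L)
    (he : ∑ j ∈ range (K - J), ((a₂ * C_F * X₁ * qU j + a₂ * φ j * (1 + r j)) / Real.sqrt (F.L : ℝ) + ζ j * (1 + r j)) ≤ E_e)
    (hsmall : Real.exp (E_L + E_e) *
      ((a₁ * X₁ / Real.sqrt (F.L : ℝ) + a₂ * C_F * X₁) * ∑ j ∈ range (K - J), ∑ u ∈ range (j + 1), (F.L : ℝ) ^ (j - u) * qd u +
        (a₁ * X₁ / (F.L : ℝ) + a₂ * C_F * X₁ / Real.sqrt (F.L : ℝ)) * ∑ j ∈ range (K - J), ∑ u ∈ range (j + 1), (F.L : ℝ) ^ (j - u) * qU u +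
        ∑ j ∈ range (K - J), η j) ≤ 1 / 2)
    (hLflat : ∀ j, j < K - J →
      √(∑ b, ‖logVec (su2Quat (GaugeField.gaugeAct (g (j + 1)) (Averaging.iter (fun k => blockAvg (P := F.P K) (j := k) ℰp) (j + 1) U) b)) -
                logVec (su2Quat (GaugeField.gaugeAct (g₀ (j + 1)) (Averaging.iter (fun k => blockAvg (P := F.P K) (j := k) ℰp) (j + 1) U₀) b))‖ ^ 2) ≤
        (1 + r j) * √(∑ b, dist1 (GaugeField.gaugeAct (g (j + 1)) (Averaging.iter (fun k => blockAvg (P := F.P K) (j := k) ℰp) (j + 1) U) b *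
                  (GaugeField.gaugeAct (g₀ (j + 1)) (Averaging.iter (fun k => blockAvg (P := F.P K) (j := k) ℰp) (j + 1) U₀) b)⁻¹) ^ 2))
    (hF1 : ∀ t, t ≤ K - J →
      √(∑ q, dist1 ((GaugeField.plaqHol (GaugeField.gaugeAct (g₀ t) (Averaging.iter (fun k => blockAvg (P := F.P K) (j := k) ℰp) t U₀)) q)⁻¹ *
                  GaugeField.plaqHol (GaugeField.gaugeAct (g t) (Averaging.iter (fun k => blockAvg (P := F.P K) (j := k) ℰp) t U)) q) ^ 2) ≤
        X₁ * (Real.sqrt (F.L : ℝ) ^ t * √(∑ p, dist1 ((GaugeField.plaqHol (GaugeField.gaugeAct (g₀ 0) U₀) p)⁻¹ * GaugeField.plaqHol (GaugeField.gaugeAct (g 0) U) p) ^ 2) +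
          ∑ s ∈ range t, Real.sqrt (F.L : ℝ) ^ (t - 1 - s) * ηA s))
    (hηA : ∀ s, s < K - J → ηA s ≤ qd s * √(∑ b, dist1 (GaugeField.gaugeAct (g s) (Averaging.iter (fun k => blockAvg (P := F.P K) (j := k) ℰp) s U) b *
                  (GaugeField.gaugeAct (g₀ s) (Averaging.iter (fun k => blockAvg (P := F.P K) (j := k) ℰp) s U₀) b)⁻¹) ^ 2) +
        qU s * √(∑ b, dist1 (GaugeField.gaugeAct (g (s + 1)) (Averaging.iter (fun k => blockAvg (P := F.P K) (j := k) ℰp) (s + 1) U) b *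
                  (GaugeField.gaugeAct (g₀ (s + 1)) (Averaging.iter (fun k => blockAvg (P := F.P K) (j := k) ℰp) (s + 1) U₀) b)⁻¹) ^ 2))
    (hF2 : ∀ j, j < K - J →
      √(∑ b, dist1 (GaugeField.gaugeAct (g j) (Averaging.iter (fun k => blockAvg (P := F.P K) (j := k) ℰp) j U) b *
                (lift j (GaugeField.gaugeAct (g (j + 1)) (Averaging.iter (fun k => blockAvg (P := F.P K) (j := k) ℰp) (j + 1) U)) b)⁻¹ *
              (GaugeField.gaugeAct (g₀ j) (Averaging.iter (fun k => blockAvg (P := F.P K) (j := k) ℰp) j U₀) b *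
                (lift j (GaugeField.gaugeAct (g₀ (j + 1)) (Averaging.iter (fun k => blockAvg (P := F.P K) (j := k) ℰp) (j + 1) U₀)) b)⁻¹)⁻¹) ^ 2) ≤
        a₁ * √(∑ q, dist1 ((GaugeField.plaqHol (GaugeField.gaugeAct (g₀ j) (Averaging.iter (fun k => blockAvg (P := F.P K) (j := k) ℰp) j U₀)) q)⁻¹ *
                  GaugeField.plaqHol (GaugeField.gaugeAct (g j) (Averaging.iter (fun k => blockAvg (P := F.P K) (j := k) ℰp) j U)) q) ^ 2) +
          a₂ * √(∑ q, dist1 ((GaugeField.plaqHol (lift j (GaugeField.gaugeAct (g₀ (j + 1)) (Averaging.iter (fun k => blockAvg (P := F.P K) (j := k) ℰp) (j + 1) U₀))) q)⁻¹ *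
                  GaugeField.plaqHol (lift j (GaugeField.gaugeAct (g (j + 1)) (Averaging.iter (fun k => blockAvg (P := F.P K) (j := k) ℰp) (j + 1) U))) q) ^ 2) +
          η j * √(∑ b, dist1 (GaugeField.gaugeAct (g j) (Averaging.iter (fun k => blockAvg (P := F.P K) (j := k) ℰp) j U) b *
                  (GaugeField.gaugeAct (g₀ j) (Averaging.iter (fun k => blockAvg (P := F.P K) (j := k) ℰp) j U₀) b)⁻¹) ^ 2) +
          ζ j * √(∑ b, dist1 (lift j (GaugeField.gaugeAct (g (j + 1)) (Averaging.iter (fun k => blockAvg (P := F.P K) (j := k) ℰp) (j + 1) U)) b *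
                  (lift j (GaugeField.gaugeAct (g₀ (j + 1)) (Averaging.iter (fun k => blockAvg (P := F.P K) (j := k) ℰp) (j + 1) U₀)) b)⁻¹) ^ 2))
    (hF3 : ∀ j, j < K - J →
      √(∑ q, dist1 ((GaugeField.plaqHol (lift j (GaugeField.gaugeAct (g₀ (j + 1)) (Averaging.iter (fun k => blockAvg (P := F.P K) (j := k) ℰp) (j + 1) U₀))) q)⁻¹ *
                  GaugeField.plaqHol (lift j (GaugeField.gaugeAct (g (j + 1)) (Averaging.iter (fun k => blockAvg (P := F.P K) (j := k) ℰp) (j + 1) U))) q) ^ 2) ≤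
        C_F * √(∑ q, dist1 ((GaugeField.plaqHol (GaugeField.gaugeAct (g₀ (j + 1)) (Averaging.iter (fun k => blockAvg (P := F.P K) (j := k) ℰp) (j + 1) U₀)) q)⁻¹ *
                  GaugeField.plaqHol (GaugeField.gaugeAct (g (j + 1)) (Averaging.iter (fun k => blockAvg (P := F.P K) (j := k) ℰp) (j + 1) U)) q) ^ 2) +
          φ j * √(∑ b, ‖logVec (su2Quat (GaugeField.gaugeAct (g (j + 1)) (Averaging.iter (fun k => blockAvg (P := F.P K) (j := k) ℰp) (j + 1) U) b)) -
                logVec (su2Quat (GaugeField.gaugeAct (g₀ (j + 1)) (Averaging.iter (fun k => blockAvg (P := F.P K) (j := k) ℰp) (j + 1) U₀) b))‖ ^ 2))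
    (hC : 0 < X₁ * (a₁ + a₂ * C_F * Real.sqrt (F.L : ℝ)))
    (hT1 : ∀ j, K - J ≤ j → ∀ y, g j y = 1) (hT1' : ∀ j, K - J ≤ j → ∀ y, g₀ j y = 1)
    (hT6 : ∀ X : GaugeField (F.P K) 0 SU2, Averaging.iter (fun k => blockAvg (P := F.P K) (j := k) ℰp) (K - J)
      (GaugeField.gaugeAct (fun x => (g 0 x)⁻¹) X) = Averaging.iter (fun k => blockAvg (P := F.P K) (j := k) ℰp) (K - J) X)
    (hres' : ∀ X : GaugeField (F.P K) 0 SU2, Averaging.iter (fun k => blockAvg (P := F.P K) (j := k) ℰp) (K - J)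
      (GaugeField.gaugeAct (g₀ 0) X) = Averaging.iter (fun k => blockAvg (P := F.P K) (j := k) ℰp) (K - J) X) :
    (∀ U' : GaugeField (F.P K) 0 SU2, descendTo F ℰp J K hJK (GaugeField.gaugeAct (fun x => (g 0 x)⁻¹ * g₀ 0 x) U') = descendTo F ℰp J K hJK U') ∧
      ((F.L : ℝ)⁻¹) ^ (2 * (K - J)) * ∑ ℓ : PBond (F.P K) 0, dist1 (U ℓ * ((GaugeField.gaugeAct (fun x => (g 0 x)⁻¹ * g₀ 0 x) U₀) ℓ)⁻¹) ^ 2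
        ≤ 8 * (Real.exp (E_L + E_e) * (X₁ * (a₁ + a₂ * C_F * Real.sqrt (F.L : ℝ))) / (F.L - 1)) ^ 2 *
          ∑ p : Plaq (F.P K) 0, (1 - reTr ((GaugeField.plaqHol (GaugeField.gaugeAct (fun x => (g 0 x)⁻¹ * g₀ 0 x) U₀) p)⁻¹ * GaugeField.plaqHol U p)) :=
  dockRel_of_towers_feedback F hJK hL U U₀ hU hU₀ lift hR1 _ _ hC g g₀ hT1 hT1' hT6 hres'
    (feedbackLetter_of_feeders F hL U U₀ lift hR1 g g₀ hX₁ ha₁ ha₂ hCF ηA r φ η ζ qd qU hr hφ hη0 hζ hqd hqU hrE he hsmall hLflat hF1 hηA hF2 hF3)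

end Summit.QuantumFields.YangMills.Theorems.FluctuationComparisonRegPrIntLS2BetaRelFlapOfFeeders

end
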